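/-
Origin: expansion seat `planner-pub-hodgecm-pv11-g3-0`, handover #1 2026-08-18T06:13:17Z (`HOME/pub-hodgecm-pv11-g3/lean/Pv11g3/SupplyAdelic.lean`, md5 4c6f23ff, 377 lines);
landed by the gen-6 packager in gate run 24 as `HodgeCM/PerL34/SupplyAdelic.lean` (verbatim).
-/
/-
Origin: HOME/pub-hodgecm-pv11-g3/lean/Pv11g3/SupplyAdelic.lean — session planner-pub-hodgecm-pv11-g3-0
(unit pub-hodgecm-pv11-g3, DAG-NODE PROVER #11 gen 3; successor of pv11 `SupplyElementary`/`SupplyDictionary`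
and pv11-g2 `SupplyDictionaryE`).  Intended place: `HodgeCM/PerL34/SupplyAdelic.lean` (imports are the LANDED
modules `HodgeCM.PerL34.SupplyDictionaryE`, `HodgeCM.PerL34.CharSeparation`, `HodgeCM.Literature.WeilTheta1964`;
no import rewrite needed).
-/
import Summits.HodgeConjecture.HodgeCM.PerL34.SupplyDictionaryE
import Summits.HodgeConjecture.HodgeCM.PerL34.CharSeparation_2
import Summits.HodgeConjecture.HodgeCM.Literature.WeilTheta1964

/-!
# Route (E) bridge record, gen 3: the ADELIC action, the automorphic quotient constructed, `hker`/`heq` derived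

Gen 2 (`SupplyDictionaryE.SupplyBridgeE T V c k`, run 22) feeds prover 1's open input `ThetaModel.Open_supply`
BY NAME; its non-kernel fields are `sep` (kernel by name since `CharSeparation.charSeparating`), the
dictionary fields `hker` (D4, definition level), `hcont`, `heq` (D5) and the residual `form_of_lift`.  It also
reads the shell carrier `DS.A₁` — documented in `Seesaw.ThetaSeesawData` as the ADELIC group `U(W_j)(𝔸)` — as a
COMPACT group, i.e. as the automorphic quotient `[U(W_j)] = U(W_j)(L₀) \ U(W_j)(𝔸)`, through which the Weil
action `ω` does NOT factor (only theta values do); the gen-2 record is instantiable by the intended objects only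
through a set-theoretic section of `U(W_j)(𝔸) → [U(W_j)]`.

Gen 3 (`SupplyBridgeA T V c k`, this file) removes that tension and derives `hker`, `heq` (and `hcont` on the
quotient) from data one level closer to the definitions:

* SETUP: `DS.A₁ = U(W_j)(𝔸)` a Hausdorff abelian topological group (`W_j` is a line, `U(W_j) = U(1)`), acting by
  `DS.ω₁ g₀`; the rational points `rat = U(W_j)(L₀) ≤ U(W_j)(𝔸)`, DISCRETE (PRINT) with COMPACT quotient
  `U(W_j)(𝔸) ⧸ U(W_j)(L₀)` (PRINT: compactness criterion for anisotropic groups); the archimedean torus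
  `i : U(W_j)(L₀ ⊗ ℝ) →* U(W_j)(𝔸)` with weight `w`; an invariant finite measure of full support `ν` on the
  quotient (`du` of PerL l. 264); the rational/archimedean carriers `VK, Vf, ιf, Lhat, E, LE, ι, f, x₀` exactly as
  in gen 2;
* DICTIONARY at DEFINITION level: `eX : DS.X₁ ≃ V(K)` (the summation index of the theta series IS `V(K)`);
  `ev_phiN` (the values of the pure tensor `φ_N = φ_∞ ⊗ 1_{x₀ + N L̂}` at rational points); `act_one`, `act_mul`,
  `act_smul`, `ev_smul` (`u ↦ ω(g₀,u)` is a representation by linear operators and `ev` is evaluation — `g₀ = 1`);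
* ONE atomic D5 field `weight` (`φ_N` is a weight-`w` vector of the archimedean torus: the Fock-model fact behind
  PerL's "type forced by `φ_∞`");
* PRINT (Weil 1964, Théorème 6, conjuncts 1 and 2, pulled back along the continuous HKS splitting
  `U(W_j)(𝔸) → Mp(𝕎)_𝔸` which carries `U(W_j)(L₀)` into `r_k(Ps(𝕎)_k)`): `cont` (continuity of
  `u ↦ θ_{φ_N}(g₀,u)` on `U(W_j)(𝔸)`) and `inv` (its left `U(W_j)(L₀)`-invariance) — § 4 below DERIVES both from
  the landed verbatim statement `Literature.Theta.WeilThetaDatum.ThetaContinuousInvariant` and a splitting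
  dictionary (`cont_inv_of_weil`), so a consumer may fill them BY NAME;
* RESIDUAL ((β) + D1/D5, named, NOT kernel): `form_of_lift`, now stated on the constructed quotient.

KERNEL here: the `w`-equivariance `θ_{φ_N}(g₀, u·i(t)) = w(t) θ_{φ_N}(g₀,u)` on `U(W_j)(𝔸)` (§ 2, from the DEF
fields + `weight`); the value at the base point `θ_{φ_N}(g₀,1) = Σ'_{ξ ∈ V(K)} 1[ι_f ξ ∈ ι_f x₀ + N L̂] f(ι ξ)`
(§ 2, from `act_one`, `ev_phiN`, `eX`); the DESCENT of the theta kernel to the automorphic quotient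
`U(W_j)(𝔸) ⧸ U(W_j)(L₀)` (a compact Hausdorff abelian group — `QuotientGroup`, closedness of a discrete subgroup),
its continuity and equivariance there (§ 1, § 3); completeness of characters of the quotient BY NAME
(`CharSeparation.charSeparating`, pv06-g2); the archimedean-lattice non-vanishing for `N ≫ 0` and the Fourier
coefficient / forcing of the type (gen 1–2 kernel: `LatticeTheta`, `RationalCoset`, `SupplyCoset`,
`GlobalLatticeDiscrete`, `SupplyElementary.supply_elementary`); hence `supply_of_bridgeA` and
`open_supply_of_bridgesA : (bridges for k = 0, 1 in every good context) → T.Open_supply`.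

No statement of the 2001 programme, of PerL or of QW8 is used or cited.  Weil 1964 and HKS 1996 enter only
through the landed `HodgeCM/Literature/*.lean` names or as docstring locators of hypothesis FIELDS.
-/

set_option autoImplicit false

noncomputable section

open MeasureTheory Filter Topology
open scoped SchwartzMap
open HodgeCM.PerL34.Seesaw HodgeCM.PerL34.SupplyElementary HodgeCM.PerL34.RationalCoset
  HodgeCM.PerL34.SupplyCoset HodgeCM.PerL34.LatticeTheta

namespace HodgeCM
namespace PerL34
namespace SupplyAdelic

/-! ### § 1. Descent of a left-invariant function to the quotient by a subgroup (abelian case) -/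

section Descent

variable {A : Type*} [CommGroup A] (Γ : Subgroup A)

/-- A function on `A` invariant under left translation by `Γ` descends to `A ⧸ Γ`. -/
def descend (F : A → ℂ) (hF : ∀ γ ∈ Γ, ∀ u : A, F (γ * u) = F u) : A ⧸ Γ → ℂ :=
  Quotient.lift F fun a b (hab : (QuotientGroup.leftRel Γ) a b) => by
    rw [QuotientGroup.leftRel_apply] at hab
    have h := hF (a⁻¹ * b) hab a
    rw [show a⁻¹ * b * a = b by rw [mul_comm, ← mul_assoc, mul_inv_cancel, one_mul]] at h
    exact h.symm

variable {Γ}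

/-- (Ported verbatim from the HodgeCMPerL package; no docstring in the source.) -/
@[simp] theorem descend_mk (F : A → ℂ) (hF : ∀ γ ∈ Γ, ∀ u : A, F (γ * u) = F u) (u : A) :
    descend Γ F hF (u : A ⧸ Γ) = F u := rfl

/-- (Ported verbatim from the HodgeCMPerL package; no docstring in the source.) -/
theorem continuous_descend [TopologicalSpace A] (F : A → ℂ) (hF : ∀ γ ∈ Γ, ∀ u : A, F (γ * u) = F u)
    (hc : Continuous F) : Continuous (descend Γ F hF) :=
  hc.quotient_lift _

/-- Equivariance under a map `i : B →* A` with weight `w` descends. -/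
theorem descend_mul_mk (F : A → ℂ) (hF : ∀ γ ∈ Γ, ∀ u : A, F (γ * u) = F u) {B : Type*} [Monoid B]
    (i : B →* A) (w : B → ℂ) (heq : ∀ (u : A) (t : B), F (u * i t) = w t * F u) (q : A ⧸ Γ) (t : B) :
    descend Γ F hF (q * (i t : A)) = w t * descend Γ F hF q := by
  induction q using QuotientGroup.induction_on with
  | H u => rw [← QuotientGroup.mk_mul, descend_mk, descend_mk, heq]

/-- The quotient of a Hausdorff group by a discrete subgroup is Hausdorff. -/
theorem t2Space_quotient [TopologicalSpace A] [IsTopologicalGroup A] [T2Space A] [DiscreteTopology Γ] :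
    T2Space (A ⧸ Γ) := by
  haveI : IsClosed (Γ : Set A) := Subgroup.isClosed_of_discrete
  infer_instance

end Descent

/-! ### § 2. The gen-3 bridge record -/

variable {U : Universe} (T : U.ThetaModel)
variable {L : CMField} {ι₁ : L →+* ℂ} (V : HermSpace3 L ι₁) (c : SeesawCtx L) (k : Fin 4)

/-- **The route-(E) bridge record, gen 3** for the theta one-forms of type index `k` (labels of the fields:
module docstring — SETUP / DICTIONARY-DEF / D5 `weight` / PRINT `cont`, `inv` / RESIDUAL `form_of_lift`). -/
structure SupplyBridgeA where
  /-- SETUP (D4′): the theta shell; `DS.A₁ = U(W_j)(𝔸)` (as documented in `ThetaSeesawData`) -/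
  DS : ThetaSeesawData
  [instA : CommGroup DS.A₁]
  [instT : TopologicalSpace DS.A₁]
  [instTG : IsTopologicalGroup DS.A₁]
  /-- SETUP: the adelic topology is Hausdorff -/
  [instT2 : T2Space DS.A₁]
  /-- SETUP: the rational points `U(W_j)(L₀) ≤ U(W_j)(𝔸)` -/
  rat : Subgroup DS.A₁
  /-- PRINT (rational points are discrete in adelic points: Cassels–Fröhlich (eds.), *Algebraic Number Theory*,
  Ch. II § 14, Theorem "`k` is discrete in `V_k` and `V_k⁺/k⁺` is compact" [held `book:editornd-algebraic-number-theory`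
  p0115 L43], whence Ch. X (Kneser), introduction: "Since `K` is a discrete subgroup of `A`, it follows that `G_K`
  is a discrete subgroup of `G_A`" [ibid. p0288 L5]; applied to `G = Res_{L₀/ℚ} U(W_j)`) -/
  [instD : DiscreteTopology rat]
  /-- PRINT (compactness: Godement, *Domaines fondamentaux des groupes arithmétiques*, Sém. Bourbaki 257
  (1962/63) § 3, THEOREM 2 (ONO) "Let `G` be a solvable linear algebraic group defined over `k`; the space
  `G_A°/G_k` is compact" and § 5, THEOREM 4 (BOREL–HARISH-CHANDRA) "… In order that `G_A°/G_k` is compact it is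
  necessary and sufficient that `G` is anisotropic" [held, English transl. in Ji (ed.) 2020,
  `book:borel2020-arithmetic-groups-reduction-theory-edited-by-lizhen` p0159 L21, p0161 L7; `G_A°` = the `g` with
  `|χ(g)| = 1` for every `k`-rational character `χ`, p0156]; for the `ℚ`-torus `G = Res_{L₀/ℚ} U(W_j)`,
  `U(W_j) = U(1)_{L/L₀}` anisotropic, there is no non-trivial rational character, so `G_A° = G_A` and
  `U(W_j)(𝔸) ⧸ U(W_j)(L₀)` is compact) -/
  [instQ : CompactSpace (DS.A₁ ⧸ rat)]
  /-- SETUP: a σ-algebra and an invariant finite measure of full support on `[U(W_j)]` (`du`, PerL l. 264) -/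
  [instM : MeasurableSpace (DS.A₁ ⧸ rat)]
  [instB : BorelSpace (DS.A₁ ⧸ rat)]
  ν : Measure (DS.A₁ ⧸ rat)
  [instF : IsFiniteMeasure ν]
  [instO : ν.IsOpenPosMeasure]
  [instR : ν.IsMulRightInvariant]
  /-- SETUP: the archimedean torus `U(W_j)(L₀ ⊗ ℝ)` and its embedding as the archimedean component -/
  B : Type
  [instBM : Monoid B]
  i : B →* DS.A₁
  /-- SETUP: the weight of `φ_∞` under `U(W_j)(L₀ ⊗ ℝ)` -/
  w : B → ℂ
  /-- SETUP: the rational points `V(K)` -/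
  VK : Type
  [instVK : AddCommGroup VK]
  [instVKQ : Module ℚ VK]
  /-- SETUP: the finite-adelic points `V(𝔸_f)` -/
  Vf : Type
  [instVf : AddCommGroup Vf]
  [instVfQ : Module ℚ Vf]
  /-- SETUP: the diagonal map `V(K) → V(𝔸_f)` -/
  ιf : VK →ₗ[ℚ] Vf
  /-- SETUP: the adelic lattice `L̂ ⊂ V(𝔸_f)` -/
  Lhat : Submodule ℤ Vf
  /-- SETUP: the archimedean completion `V_∞` -/
  E : Type
  [instE : NormedAddCommGroup E]
  [instEℝ : NormedSpace ℝ E]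
  [instEfd : FiniteDimensional ℝ E]
  /-- SETUP: a discrete lattice of `V_∞` containing the image of `L = V(K) ∩ L̂` -/
  LE : Submodule ℤ E
  [instLE : DiscreteTopology LE]
  /-- SETUP: the diagonal map `V(K) → V_∞`, injective on `L`, with `ι(L) ⊂ LE` -/
  ι : VK →+ E
  hL : ∀ v ∈ globalLattice ιf Lhat, ι v ∈ LE
  hinj : Set.InjOn ι (globalLattice ιf Lhat)
  /-- SETUP: the archimedean Schwartz function `φ_∞`, non-zero at the rational point `x₀` -/
  f : 𝓢(E, ℂ)
  x₀ : VK
  hx₀ : f (ι x₀) ≠ 0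
  /-- SETUP: the family of test functions `φ_N ∈ 𝒮((V₃ ⊗ W_j)(𝔸))` and the base point `g₀ = 1 ∈ G_U(𝔸)` -/
  φN : ℕ → DS.S₁
  g₀ : DS.G
  /-- DICTIONARY (index, definition level): the summation index of the theta series is `V(K)` -/
  eX : DS.X₁ ≃ VK
  /-- DICTIONARY (D4, definition level): the values of the pure tensor `φ_N = φ_∞ ⊗ 1_{x₀ + N L̂}` at rational
  points: `φ_N(ξ) = 1[ι_f ξ ∈ ι_f x₀ + N L̂] · φ_∞(ι ξ)` -/
  ev_phiN : ∀ N : ℕ, N ≠ 0 → ∀ x : DS.X₁,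
    DS.ev₁ (φN N) x = (thinCosetK ιf Lhat x₀ N).indicator (fun ξ => f (ι ξ)) (eX x)
  /-- DICTIONARY (definition level): `u ↦ ω(g₀,u)` is a representation of `U(W_j)(𝔸)` (`g₀ = 1`; the HKS splitting
  is a homomorphism) … -/
  act_one : ∀ φ : DS.S₁, DS.ω₁ g₀ 1 φ = φ
  act_mul : ∀ (u v : DS.A₁) (φ : DS.S₁), DS.ω₁ g₀ (u * v) φ = DS.ω₁ g₀ u (DS.ω₁ g₀ v φ)
  /-- … by `ℂ`-linear (here: `ℂ`-homogeneous) operators, and `ev` (evaluation at a rational point) is linear -/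
  [instS : SMul ℂ DS.S₁]
  act_smul : ∀ (u : DS.A₁) (a : ℂ) (φ : DS.S₁), DS.ω₁ g₀ u (a • φ) = a • DS.ω₁ g₀ u φ
  ev_smul : ∀ (a : ℂ) (φ : DS.S₁) (x : DS.X₁), DS.ev₁ (a • φ) x = a * DS.ev₁ φ x
  /-- D5 (atomic): `φ_N` is a weight-`w` vector of the archimedean torus (`φ_∞` lies in the `w`-isotypic part of
  the Fock model; the finite part `1_{x₀ + N L̂}` is untouched by `U(W_j)(L₀ ⊗ ℝ)`) -/
  weight : ∀ (N : ℕ) (t : B), DS.ω₁ g₀ (i t) (φN N) = w t • φN N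
  /-- PRINT (Weil 1964 Thm 6, conjunct 1, along the continuous splitting; cf. `cont_inv_of_weil`): continuity of
  the theta kernel on `U(W_j)(𝔸)` -/
  cont : ∀ N : ℕ, Continuous fun u => DS.thetaKernel₁ (φN N) g₀ u
  /-- PRINT (Weil 1964 Thm 6, conjunct 2, the splitting carrying `U(W_j)(L₀)` into `r_k(Ps_k)`; cf.
  `cont_inv_of_weil`): left `U(W_j)(L₀)`-invariance of the theta kernel -/
  inv : ∀ N : ℕ, ∀ γ ∈ rat, ∀ u : DS.A₁, DS.thetaKernel₁ (φN N) g₀ (γ * u) = DS.thetaKernel₁ (φN N) g₀ u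
  /-- RESIDUAL ((β) + D1/D5, named; NOT kernel in this package): a non-zero automorphic theta lift
  `θ(φ_N, χ)(g₀) = ∫_{[U(W_j)]} θ_{φ_N}(g₀,u) χ(u) du` against an automorphic character `χ` of the archimedean type
  forced by `w` yields a non-zero theta one-form of type index `k` at some level -/
  form_of_lift : ∀ (N : ℕ) (χ : PontryaginDual (DS.A₁ ⧸ rat)), 0 < N →
    (∀ t : B, ((χ ((i t : DS.A₁) : DS.A₁ ⧸ rat) : Circle) : ℂ) * w t = 1) →
    (∫ q, descend rat (fun u => DS.thetaKernel₁ (φN N) g₀ u) (inv N) q * ((χ q : Circle) : ℂ) ∂ν) ≠ 0 →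
      ∃ Γ : Level V, ∃ ω ∈ T.Theta V c k Γ, ω ≠ 0

attribute [instance] SupplyBridgeA.instA SupplyBridgeA.instT SupplyBridgeA.instTG SupplyBridgeA.instT2
  SupplyBridgeA.instD SupplyBridgeA.instQ SupplyBridgeA.instM SupplyBridgeA.instB SupplyBridgeA.instF
  SupplyBridgeA.instO SupplyBridgeA.instR SupplyBridgeA.instBM SupplyBridgeA.instVK SupplyBridgeA.instVKQ
  SupplyBridgeA.instVf SupplyBridgeA.instVfQ SupplyBridgeA.instE SupplyBridgeA.instEℝ SupplyBridgeA.instEfd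
  SupplyBridgeA.instLE SupplyBridgeA.instS

namespace SupplyBridgeA

variable {T V c k} (Br : SupplyBridgeA T V c k)

/-- The theta kernel `u ↦ θ_{φ_N}(g₀,u)` on `U(W_j)(𝔸)`. -/
def theta (N : ℕ) (u : Br.DS.A₁) : ℂ := Br.DS.thetaKernel₁ (Br.φN N) Br.g₀ u

/-- (Ported verbatim from the HodgeCMPerL package; no docstring in the source.) -/
theorem theta_def (N : ℕ) (u : Br.DS.A₁) :
    Br.theta N u = ∑' x, Br.DS.ev₁ (Br.DS.ω₁ Br.g₀ u (Br.φN N)) x := rfl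

/-- KERNEL (was D5 `heq`): `w`-equivariance of the theta kernel under the archimedean torus, from the
representation property, homogeneity and the weight of `φ_N`. -/
theorem theta_mul_i (N : ℕ) (u : Br.DS.A₁) (t : Br.B) : Br.theta N (u * Br.i t) = Br.w t * Br.theta N u := by
  rw [theta_def, theta_def, Br.act_mul, Br.weight, Br.act_smul, ← tsum_mul_left]
  exact tsum_congr fun x => Br.ev_smul _ _ _

/-- KERNEL (was D4 `hker`): the theta kernel at the base point is the sum of `φ_N` over the rational points,
i.e. the archimedean Schwartz function summed over the thin coset `V(K) ∩ (x₀ + N L̂)`. -/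
theorem theta_one (N : ℕ) (hN : N ≠ 0) :
    Br.theta N 1 = ∑' ξ : Br.VK, (thinCosetK Br.ιf Br.Lhat Br.x₀ N).indicator (fun ξ => Br.f (Br.ι ξ)) ξ := by
  rw [theta_def]
  simp_rw [Br.act_one, Br.ev_phiN N hN]
  exact Br.eX.tsum_eq (fun ξ => (thinCosetK Br.ιf Br.Lhat Br.x₀ N).indicator (fun ξ => Br.f (Br.ι ξ)) ξ)

/-! ### § 3. The descended kernel on `[U(W_j)] = U(W_j)(𝔸) ⧸ U(W_j)(L₀)` and the supply -/

/-- The automorphic theta kernel `θ̄_N : [U(W_j)] → ℂ`. -/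
def thetaBar (N : ℕ) : Br.DS.A₁ ⧸ Br.rat → ℂ := descend Br.rat (Br.theta N) (Br.inv N)

/-- (Ported verbatim from the HodgeCMPerL package; no docstring in the source.) -/
@[simp] theorem thetaBar_mk (N : ℕ) (u : Br.DS.A₁) : Br.thetaBar N (u : Br.DS.A₁ ⧸ Br.rat) = Br.theta N u := rfl

/-- (Ported verbatim from the HodgeCMPerL package; no docstring in the source.) -/
theorem continuous_thetaBar (N : ℕ) : Continuous (Br.thetaBar N) :=
  continuous_descend _ _ (Br.cont N)

/-- The archimedean torus mapped to the automorphic quotient. -/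
def iBar : Br.B →* Br.DS.A₁ ⧸ Br.rat := (QuotientGroup.mk' Br.rat).comp Br.i

/-- (Ported verbatim from the HodgeCMPerL package; no docstring in the source.) -/
@[simp] theorem iBar_apply (t : Br.B) : Br.iBar t = ((Br.i t : Br.DS.A₁) : Br.DS.A₁ ⧸ Br.rat) := rfl

/-- (Ported verbatim from the HodgeCMPerL package; no docstring in the source.) -/
theorem thetaBar_mul_iBar (N : ℕ) (q : Br.DS.A₁ ⧸ Br.rat) (t : Br.B) :
    Br.thetaBar N (q * Br.iBar t) = Br.w t * Br.thetaBar N q :=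
  descend_mul_mk _ _ Br.i Br.w (Br.theta_mul_i N) q t

/-- The automorphic theta kernel as an element of `C([U(W_j)], ℂ)`. -/
def thetaBarC (N : ℕ) : C(Br.DS.A₁ ⧸ Br.rat, ℂ) := ⟨Br.thetaBar N, Br.continuous_thetaBar N⟩

/-- (Ported verbatim from the HodgeCMPerL package; no docstring in the source.) -/
@[simp] theorem thetaBarC_apply (N : ℕ) (q : Br.DS.A₁ ⧸ Br.rat) : Br.thetaBarC N q = Br.thetaBar N q := rfl

/-- The automorphic theta lift `θ(φ_N, χ)(g₀) = ∫_{[U(W_j)]} θ̄_N(q) χ(q) dν(q)`. -/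
def lift (N : ℕ) (χ : PontryaginDual (Br.DS.A₁ ⧸ Br.rat)) : ℂ :=
  ∫ q, Br.thetaBar N q * ((χ q : Circle) : ℂ) ∂Br.ν

/-- KERNEL (archimedean lattice sums, gen 2): for `N ≫ 0` the theta kernel does not vanish at the base point. -/
theorem exists_theta_one_ne_zero : ∃ N : ℕ, 0 < N ∧ Br.theta N 1 ≠ 0 := by
  haveI := GlobalLatticeDiscrete.finite_of_embedding Br.hL Br.hinj
  haveI := GlobalLatticeDiscrete.free_of_embedding Br.hL Br.hinj
  obtain ⟨ℓ, hℓ0, hℓ⟩ := exists_latticeSize (globalLattice Br.ιf Br.Lhat)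
  have hΦ := summable_norm_schwartz_comp Br.ιf Br.Lhat Br.LE Br.ι Br.hL Br.hinj Br.f Br.x₀
  have hlim := tendsto_tsum_nsmul ℓ hℓ0 hℓ
    (fun v : globalLattice Br.ιf Br.Lhat => Br.f (Br.ι (Br.x₀ + (v : Br.VK)))) hΦ
  have h0 : Br.f (Br.ι (Br.x₀ + ((0 : globalLattice Br.ιf Br.Lhat) : Br.VK))) ≠ 0 := by simpa using Br.hx₀
  obtain ⟨N, hNpos, hN⟩ := ((eventually_gt_atTop 0).and (hlim.eventually_ne h0)).exists
  refine ⟨N, hNpos, ?_⟩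
  rw [Br.theta_one N hNpos.ne', tsum_indicator_thinCosetK' Br.ιf Br.Lhat hNpos.ne' Br.x₀ (fun ξ => Br.f (Br.ι ξ))]
  exact hN

/-- **SUPPLY on the automorphic quotient (kernel modulo the labelled fields):** for some `N ≥ 1` and some
continuous unitary character `χ` of `[U(W_j)]` of the archimedean type forced by `w`, the automorphic theta lift
`θ(φ_N, χ)(g₀)` is non-zero. -/
theorem supply : ∃ (N : ℕ) (χ : PontryaginDual (Br.DS.A₁ ⧸ Br.rat)), 0 < N ∧ Br.lift N χ ≠ 0 ∧
    ∀ t : Br.B, ((χ (Br.iBar t) : Circle) : ℂ) * Br.w t = 1 := by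
  haveI : T2Space (Br.DS.A₁ ⧸ Br.rat) := t2Space_quotient
  obtain ⟨N, hNpos, hN⟩ := Br.exists_theta_one_ne_zero
  have hθ0 : Br.thetaBarC N ≠ 0 := by
    intro h
    apply hN
    have h1 : Br.thetaBarC N ((1 : Br.DS.A₁) : Br.DS.A₁ ⧸ Br.rat) = 0 := by rw [h]; rfl
    rwa [thetaBarC_apply, thetaBar_mk] at h1
  obtain ⟨χ, h1, h2⟩ := supply_elementary Br.ν (CharSeparation.charSeparating) Br.iBar Br.w (Br.thetaBarC N)
    hθ0 (fun q t => by simpa using Br.thetaBar_mul_iBar N q t)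
  exact ⟨N, χ, hNpos, by simpa [lift] using h1, h2⟩

include Br in
/-- **Supply of type index `k` from a gen-3 bridge record**: KERNEL + the one residual field. -/
theorem supply_of_bridgeA : ∃ Γ : Level V, ∃ ω ∈ T.Theta V c k Γ, ω ≠ 0 := by
  obtain ⟨N, χ, hN, hne, htype⟩ := Br.supply
  exact Br.form_of_lift N χ hN (fun t => by simpa using htype t) hne

end SupplyBridgeA

variable {T V c k}

variable (T) in
/-- **`Open_supply` BY NAME on the § 10 path, gen 3**: a gen-3 bridge record for each of the type indices `0, 1`
in every good context gives prover 1's `ThetaModel.Open_supply`. -/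
theorem open_supply_of_bridgesA
    (hB : ∀ {L : CMField} {ι₁ : L →+* ℂ} (V : HermSpace3 L ι₁) (c : SeesawCtx L), T.GoodCtx ι₁ c →
      Nonempty (SupplyBridgeA T V c 0) ∧ Nonempty (SupplyBridgeA T V c 1)) :
    T.Open_supply := by
  intro L ι₁ V c hc
  obtain ⟨⟨B₀⟩, ⟨B₁⟩⟩ := hB V c hc
  exact ⟨B₀.supply_of_bridgeA, B₁.supply_of_bridgeA⟩

variable (T) in
/-- Mixed form: per type index, a bridge record of ANY generation (1, 2 or 3) suffices. -/
theorem open_supply_of_bridges''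
    (hB : ∀ {L : CMField} {ι₁ : L →+* ℂ} (V : HermSpace3 L ι₁) (c : SeesawCtx L), T.GoodCtx ι₁ c →
      (Nonempty (SupplyDictionary.SupplyBridge T V c 0) ∨ Nonempty (SupplyDictionaryE.SupplyBridgeE T V c 0) ∨
          Nonempty (SupplyBridgeA T V c 0)) ∧
        (Nonempty (SupplyDictionary.SupplyBridge T V c 1) ∨ Nonempty (SupplyDictionaryE.SupplyBridgeE T V c 1) ∨
          Nonempty (SupplyBridgeA T V c 1))) :
    T.Open_supply := by
  intro L ι₁ V c hc
  obtain ⟨h0, h1⟩ := hB V c hc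
  refine ⟨?_, ?_⟩
  · rcases h0 with ⟨⟨B₀⟩⟩ | ⟨⟨B₀⟩⟩ | ⟨⟨B₀⟩⟩
    · exact SupplyDictionary.supply_of_bridge B₀
    · exact SupplyDictionaryE.supply_of_bridgeE B₀
    · exact B₀.supply_of_bridgeA
  · rcases h1 with ⟨⟨B₁⟩⟩ | ⟨⟨B₁⟩⟩ | ⟨⟨B₁⟩⟩
    · exact SupplyDictionary.supply_of_bridge B₁
    · exact SupplyDictionaryE.supply_of_bridgeE B₁
    · exact B₁.supply_of_bridgeA

/-! ### § 4. `cont` and `inv` BY NAME from Weil 1964, Théorème 6, and a splitting dictionary -/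

section Weil

open HodgeCM.Literature.Theta

variable {A : Type*} [Group A] [TopologicalSpace A] (Γ : Subgroup A)

/-- **The two PRINT fields from the landed verbatim statement.**  Data: Weil's carriers `W` (`Mp(𝕎)_𝔸`,
`S(𝕎_𝔸)`, `Θ`) with HIS Théorème 6 as the hypothesis `hW : W.ThetaContinuousInvariant`; a continuous map
`s : A → Mp(𝕎)_𝔸` (DICTIONARY: `u ↦` the HKS splitting of `(g₀, u)`, continuous — [HKS96 § 1]/[Ku94]) carrying
left translations by `Γ` to left translations by rational elements `r_k(Ps_k)` (DICTIONARY: the global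
splitting restricted to rational points is the canonical rational lift); and the identification of the shell's
theta kernel with Weil's `Θ` along `s` (DICTIONARY, definition level: `θ_φ(g₀,u) = Θ(s(u))` for `Φ = φ`).
Conclusion: the kernel is continuous on `A` and left-`Γ`-invariant — the fields `cont`, `inv` of
`SupplyBridgeA` for that `N`. -/
theorem cont_inv_of_weil (W : WeilThetaDatum) (hW : W.ThetaContinuousInvariant) {s : A → W.Mp}
    (hs : Continuous s) (hsΓ : ∀ γ ∈ Γ, ∀ u : A, ∃ ρ ∈ W.rat, s (γ * u) = ρ * s u) (Φ : W.SX) (F : A → ℂ)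
    (hF : ∀ u : A, F u = W.theta Φ (s u)) :
    Continuous F ∧ ∀ γ ∈ Γ, ∀ u : A, F (γ * u) = F u := by
  refine ⟨?_, fun γ hγ u => ?_⟩
  · have h := hW.theta_comp_continuous Φ hs
    exact h.congr fun u => (hF u).symm
  · obtain ⟨ρ, hρ, hsu⟩ := hsΓ γ hγ u
    rw [hF, hF, hsu, hW.theta_left_invariant Φ hρ]

end Weil

end SupplyAdelic
end PerL34
end HodgeCM

end
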